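import Literature.Analysis.FluidPDE.UniversalTotalAnomalousDissipator
import Literature.Analysis.FunctionSpaces.HolderNorm
import Literature.Analysis.FunctionSpaces.TorusHeatKernel
import HarnessLib

/-!
# Optimal enhanced dissipation and exponential mixing by the alternating sawtooth shear flow
# `u_α` (Elgindi–Liss–Mattingly 2025, Theorems 1–3)

T. M. Elgindi, K. Liss, J. C. Mattingly, *Optimal enhanced dissipation and mixing for a
time-periodic, Lipschitz velocity field on `𝕋²`*, Duke Math. J. **174** (2025), no. 7
(doi:10.1215/00127094-2024-0057) = arXiv:2304.05374 (v1, 12 Apr 2023, the only arXiv version;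
page numbers and the numbering "Theorem 1/2/3" below are those of the arXiv PDF, page-confirmed
2026-08-27). [`ElgindiLissMattingly2025`]

Named facts (Literature is sorry-free, D-0014): `ElgindiLissMattingly2025_thm1`, `_thm2`, `_thm3`
are `def … : Prop`; users take `(h : ElgindiLissMattingly2025_thm1)` etc. This is the velocity
field whose pulse-pair structure the route `Summits/AnomalousDissipation/…/Theses/SawtoothPulseCascade`
replays across scales (`Literature.Analysis.FluidPDE.SawtoothCascade`, which cites §1 / Rmk. 1.4 of
the source for its definitions and PROVES the cone expansion of §3.1 Lemma 3.1); the three theorems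
of the source had not been typed before.

## Source, verbatim (arXiv:2304.05374v1)

* p. 2, the field: "For `α > 0`, let `H_α : 𝕋² → ℝ²` and `V_α : 𝕋² → ℝ²` (with `𝕋 ≅ [0,1]`) denote
  the shear flows `H_α(x,y) = (-2α|y - 1/2|, 0)` and `V_α(x,y) = (0, -2α|x - 1/2|)`. We then define
  the Lipschitz continuous (in space), divergence-free velocity field `u_α : [0,∞) × 𝕋² → ℝ²` by
  `u_α(t,x,y) = V_α(x,y)` for `t ∈ [0,1/2)`, `H_α(x,y)` for `t ∈ [1/2,1)`, for `t ∈ [0,1)` and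
  extended for `t ≥ 1` to be time periodic with a period of one."
* **Definition 1.1** (p. 2): "A divergence-free and time-dependent velocity field
  `u : [0,∞) × 𝕋² → ℝ²` is said to be *dissipation enhancing* if there exists a constant `C ≥ 1` and
  a rate function `δ(ν) : (0,∞) → (0,∞)` with `lim_{ν→0} ν/δ(ν) = 0` so that for all `f₀ ∈ L²` the
  solution `f` of (1) [`∂ₜf + u·∇f = νΔf`, `f|_{t=0} = f₀`] satisfies
  `‖f(t) - ⨍f₀‖_{L²} ≤ C e^{-δ(ν)t} ‖f₀ - ⨍f₀‖_{L²}` for all `t ≥ 0`."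
* **Theorem 1** (p. 3): "If `α` is a sufficiently large even integer, then the velocity field `u_α`
  is dissipation enhancing with the optimal rate function `δ(ν) = c/|log ν|`, where `c > 0` is a
  constant depending on `α` but not `ν`."
* (5)–(6) p. 3: `φ_t` is the flow map of `u` (`d/dt φ_t(z) = u(t, φ_t(z))`, `φ₀(z) = z`), "a
  (Lebesgue) measure-preserving homeomorphism for each `t ≥ 0`", and the transported scalar is
  `f(t) = f₀ ∘ φ_t⁻¹`.
* **Definition 1.2** (p. 3): "A Lipschitz and divergence-free velocity field `u` is said to be an
  *exponential mixer* if there exist `C, c > 0` so that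
  `|⨍ (f ∘ φ_t⁻¹) g - ⨍ f ⨍ g| ≤ C exp(-ct) ‖f‖_{C¹} ‖g‖_{C¹}` for any `f, g ∈ C¹(𝕋²)`."
* **Theorem 2** (p. 4): "If `α` is a sufficiently large even integer, then `u_α` is exponentially
  mixing in the sense of Definition 1.2."
* Remark 1.3 (p. 4): the restriction to EVEN INTEGERS `α` "is not important for the proof … merely
  done for convenience so that the time-1 flow map of `u_α` can be expressed in a simple way as a
  piecewise toral automorphism"; "the assumption that `α` be sufficiently large is necessary, at
  least for Theorem 2" (polynomial correlation decay for small `α`, [Hill 2023]). Remark 1.4 (p. 4):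
  both results persist for the smooth-in-time variant `φ(t)H₁`, `φ(1/2 - t)V₁`, `∫φ = α`.
* (9) p. 7: the PULSED DIFFUSION "`Φ_ν g = e^{νΔ}(g ∘ T)`, where `T = φ₁⁻¹` and `e^{νΔ}` denotes
  convolution with the periodized heat kernel"; its iterates `Φ_ν^n` ((11) p. 7). §2.1 p. 10: "In the
  statement below and all those that follow we assume that `α` is an even integer without explicit
  mention of it."
* **Theorem 3** (p. 10): "For all `α` sufficiently large there exist constants `C, c > 0` such that
  for any `ν ∈ (0,1/2]`, `p ∈ {2,∞}`, and mean-zero `f ∈ L^p(𝕋²)` there holds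
  `‖Φ_ν^n f‖_{L^p} ≤ C e^{-cn|log ν|⁻¹} ‖f‖_{L^p}`."  Theorem 1 is deduced from Theorem 3 (`p = 2`)
  and the approximation Lemma 2.4 (§2.4, p. 12); the key input Lemma 2.3 (p. 10) is proved for
  "`ν ≪ 1`" (p. 11, first line of its proof).

## Rendering (design choices; every deviation from print is a WEAKENING and is recorded here)

1. The torus is the tree's unit torus `𝕋² = UnitAddTorus (Fin 2)` (`= ℝ²/ℤ²`, the source's
   `𝕋 ≅ [0,1]`); `|y - 1/2|` is evaluated on the fundamental-domain coordinate
   `Torus.repr z 1 ∈ [0,1)` (`FunctionSpaces.Torus.repr`), which makes `H_α`, `V_α` continuous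
   (indeed Lipschitz) on `𝕋²` since `|0 - 1/2| = |1 - 1/2|`. Vector values are
   `EuclideanSpace ℝ (Fin 2)` as everywhere in the tree's passive-scalar files.
2. The flow maps are EXPLICIT (the field is a shear in each half period): `hFlow α s` / `vFlow α s`
   are the time-`s` maps of `H_α` / `V_α` (the sheared coordinate is translated by `s` times a
   function of the other, unchanged, coordinate, so `hFlow α (-s)` inverts `hFlow α s`);
   `periodMap α = hFlow α (1/2) ∘ vFlow α (1/2) = φ₁`, `periodInv α = φ₁⁻¹ = T` of (9);
   `flowMap α t = φ_t`, `flowInv α t = φ_t⁻¹` for `t ≥ 0` (within-period piece after/before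
   `⌊t⌋` full periods). The inverse relations and `flowInv α n = T^[n]` are proved in the companion
   `AlternatingSawtoothShearMixingProofs.lean`; they are not needed to STATE the theorems, which are
   typed directly over `flowInv` (Def. 1.2 only involves `φ_t⁻¹`). Values at `t < 0` are junk
   (`⌊t⌋₊ = 0`, the within-period piece at a negative time) and never used.
3. "The solution `f` of (1)" for `f₀ ∈ L²` (Def. 1.1): for this bounded, divergence-free drift and
   `ν > 0` the weak solution in `L^∞_t L²_x` is unique and has an `L²`-continuous representative, so
   — exactly as in `Rowan2024.HalvesNorm` and `HessChildsRowan2025a` — the displayed inequality is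
   asked, for every window `T > 0`, of every weak solution `θ` on `[0,T)`
   (`Torus.IsWeakScalarTransportOn T ν u f₀ θ`) which is the `L²`-continuous representative on
   `[0,T)` (`Torus.IsL2ContinuousOn`), at every `t ∈ [0,T)`; squared form with
   `Torus.scalarL2Sq` (`‖·‖²_{L²}`), the spatial average being `∫ f₀` (`𝕋²` has volume one).
   This is `ElgindiLissMattingly2025.DecaysAtRate ν u r C` (rate `r`, constant `C`), and
   `IsDissipationEnhancing u` is Definition 1.1 verbatim on top of it.
4. Theorem 1's `ν`-range. The rate function `δ(ν) = c/|log ν|` is typed on `ν ∈ (0, 1/2]`, the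
   range of Theorem 3 from which Theorem 1 is derived (§2.4) — the content of the theorem is the
   behaviour as `ν → 0` ("It suffices to consider the case where `ν ≪ 1`", p. 11); literally at
   `ν = 1` the displayed `δ` is undefined (`log 1 = 0`) and Definition 1.1's domain `(0,∞)` is
   immaterial there (for `ν ≥ 1/2` any positive rate, e.g. the heat rate, serves). So
   `_thm1 := ∃ α₀, ∀ even α ≥ α₀, ∃ C ≥ 1, ∃ c > 0, ∀ ν ∈ (0,1/2], DecaysAtRate ν (field α) (c/|log ν|) C`;
   the limit `ν / (c/|log ν|) → 0` required by Definition 1.1 of this rate is a calculus fact, proved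
   in the companion (`tendsto_mul_abs_log_div`).
5. `‖f‖_{C¹}` (Def. 1.2) for `f ∈ C¹(𝕋²)` (`FunctionSpaces.Torus.IsContDiff 1 f`) is rendered by the
   tree's bounded Lipschitz norm `FunctionSpaces.eBoundedHolderNorm 1 f = sup|f| + Lip(f)` for the
   intrinsic (product) metric of `𝕋²`; for `C¹` functions `Lip(f)` is the sup of the gradient in the
   dual norm, equivalent to `sup|f| + sup‖∇f‖` up to an absolute factor (`≤ √2`), which the
   existential constant `C` absorbs. `⨍ = ∫` on the probability space `𝕋²`.
6. "Sufficiently large even integer": `∃ α₀ : ℕ, ∀ α : ℕ, α₀ ≤ α → Even α → …`, the field being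
   `field (α : ℝ)`.
7. Theorem 3: `e^{νΔ}` = convolution with the tree's periodized heat kernel at time `ν`
   (`FunctionSpaces.Torus.heatKernel ν`, `p_ν(x) = ∑_k e^{-4π²|k|²ν} e^{2πik·x}`, i.e. the heat flow
   `∂ₜ - νΔ` run for unit time), `Φ_ν g = p_ν ⋆ (g ∘ T)` is `pulsedDiffusion α ν g`, iterates by
   `Function.iterate`; `L^p` norms are Mathlib's `eLpNorm · p volume`, `p = 2` and `p = ∞` as two
   clauses; "mean-zero `f ∈ L^p`" = `MemLp f p ∧ ∫ f = 0`.
8. NOT typed here: Remark 1.2 (the equivalent squares formulation (7) of exponential mixing),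
   Lemma 2.1 (geometric mixing lemma), Lemmas 2.2–2.4, Theorem 4 / §3 (the hyperbolicity and
   invariant-cone machinery — its Lemma 3.1 is PROVED in `SawtoothCascade.lean` in the form the
   cell uses), Remark 1.4's smooth-in-time variant (a remark; the cell's `SawtoothCascade.CascadeParams.field`
   is that variant replayed across scales).

## References

* T. M. Elgindi, K. Liss, J. C. Mattingly, Duke Math. J. 174 (2025) no. 7 = arXiv:2304.05374v1:
  Def. 1.1 and `u_α` p. 2; Thm. 1 and Def. 1.2 p. 3; Thm. 2, Rmks. 1.3–1.4 p. 4; (9), (11) p. 7;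
  Thm. 3 p. 10; §2.4 p. 12. [`ElgindiLissMattingly2025`]
* K. L. Liss, J. C. Mattingly, arXiv:2603.08904 (2026), (2.2) p. 4 (the discrete-time form of
  Theorem 2 used there; typed in `DeterministicBatchelorSpectrum.lean`). [`LissMattingly2026`]
-/

noncomputable section

namespace Literature.Analysis.FluidPDE

open _root_.MeasureTheory _root_.Set _root_.Filter
open scoped NNReal ENNReal Topology

namespace ElgindiLissMattingly2025

open FunctionSpaces

/-! ## The field `u_α` and its explicit flow -/

/-- The horizontal sawtooth shear `H_α(x,y) = (-2α|y - 1/2|, 0)` of the source (p. 2), `y ∈ [0,1)`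
the fundamental-domain coordinate (`Torus.repr z 1`); continuous and piecewise affine on `𝕋²`
(slopes `∓2α`). [cite: ElgindiLissMattingly2025, §1 p. 2 (H_α)] -/
def fieldH (α : ℝ) (z : UnitAddTorus (Fin 2)) : EuclideanSpace ℝ (Fin 2) :=
  WithLp.toLp 2 ![-2 * α * |Torus.repr z 1 - 1 / 2|, 0]

/-- The vertical sawtooth shear `V_α(x,y) = (0, -2α|x - 1/2|)` of the source (p. 2).
[cite: ElgindiLissMattingly2025, §1 p. 2 (V_α)] -/
def fieldV (α : ℝ) (z : UnitAddTorus (Fin 2)) : EuclideanSpace ℝ (Fin 2) :=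
  WithLp.toLp 2 ![0, -2 * α * |Torus.repr z 0 - 1 / 2|]

/-- **The alternating sawtooth shear flow `u_α`** (p. 2): `V_α` on `t ∈ [0,1/2)`, `H_α` on
`t ∈ [1/2,1)` (fractional part of `t`), time periodic with period one; Lipschitz in space uniformly
in time, divergence free. (The same formula is used for `t < 0`, by periodicity.)
[cite: ElgindiLissMattingly2025, §1 p. 2 (u_α)] -/
def field (α : ℝ) (t : ℝ) (z : UnitAddTorus (Fin 2)) : EuclideanSpace ℝ (Fin 2) :=
  if Int.fract t < 1 / 2 then fieldV α z else fieldH α z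

/-- The time-`s` map of the steady shear `H_α`: `(x, y) ↦ (x - 2αs|y - 1/2|, y)` (the `y`
coordinate is unchanged, so `hFlow α (-s)` is the inverse map). [cite: ElgindiLissMattingly2025, §1 (5)–(6) p. 3 (the flow map of u_α)] -/
def hFlow (α s : ℝ) (z : UnitAddTorus (Fin 2)) : UnitAddTorus (Fin 2) :=
  Function.update z 0 (z 0 + (((-2 * α * |Torus.repr z 1 - 1 / 2|) * s : ℝ) : UnitAddCircle))

/-- The time-`s` map of the steady shear `V_α`: `(x, y) ↦ (x, y - 2αs|x - 1/2|)` (inverse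
`vFlow α (-s)`). [cite: ElgindiLissMattingly2025, §1 (5)–(6) p. 3 (the flow map of u_α)] -/
def vFlow (α s : ℝ) (z : UnitAddTorus (Fin 2)) : UnitAddTorus (Fin 2) :=
  Function.update z 1 (z 1 + (((-2 * α * |Torus.repr z 0 - 1 / 2|) * s : ℝ) : UnitAddCircle))

/-- The time-one map `φ₁ = (H_α for time 1/2) ∘ (V_α for time 1/2)` of `u_α` (for an even integer
`α` a piecewise toral automorphism, Rmk. 1.3). [cite: ElgindiLissMattingly2025, §1 (5) p. 3 and Rmk. 1.3 p. 4] -/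
def periodMap (α : ℝ) : UnitAddTorus (Fin 2) → UnitAddTorus (Fin 2) :=
  hFlow α (1 / 2) ∘ vFlow α (1 / 2)

/-- The inverse time-one map `T = φ₁⁻¹` of (9) p. 7 (undo the `H` half, then the `V` half).
[cite: ElgindiLissMattingly2025, (9) p. 7 (T = φ₁⁻¹)] -/
def periodInv (α : ℝ) : UnitAddTorus (Fin 2) → UnitAddTorus (Fin 2) :=
  vFlow α (-(1 / 2)) ∘ hFlow α (-(1 / 2))

/-- The flow of `u_α` within one period, from time `0` to time `s ∈ [0,1]`: `V_α` for
`min s 1/2`, then `H_α` for the remaining `s - 1/2` if `s > 1/2`. [cite: ElgindiLissMattingly2025, §1 (5) p. 3] -/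
def withinPeriod (α s : ℝ) : UnitAddTorus (Fin 2) → UnitAddTorus (Fin 2) :=
  if s ≤ 1 / 2 then vFlow α s else hFlow α (s - 1 / 2) ∘ vFlow α (1 / 2)

/-- The inverse of `withinPeriod α s`. [cite: ElgindiLissMattingly2025, §1 (5)–(6) p. 3] -/
def withinPeriodInv (α s : ℝ) : UnitAddTorus (Fin 2) → UnitAddTorus (Fin 2) :=
  if s ≤ 1 / 2 then vFlow α (-s) else vFlow α (-(1 / 2)) ∘ hFlow α (-(s - 1 / 2))

/-- **The flow map `φ_t` of `u_α`** ((5) p. 3), `t ≥ 0`: `⌊t⌋` full periods followed by the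
within-period flow for the remaining time `t - ⌊t⌋`. (Junk for `t < 0`.) [cite: ElgindiLissMattingly2025, §1 (5) p. 3] -/
def flowMap (α t : ℝ) : UnitAddTorus (Fin 2) → UnitAddTorus (Fin 2) :=
  withinPeriod α (t - ⌊t⌋₊) ∘ (periodMap α)^[⌊t⌋₊]

/-- **The inverse flow map `φ_t⁻¹` of `u_α`** ((6) p. 3: the transported scalar is
`f(t) = f₀ ∘ φ_t⁻¹`), `t ≥ 0`; at integer times `flowInv α n = T^[n]`, `T = periodInv α`
(companion file). (Junk for `t < 0`.) [cite: ElgindiLissMattingly2025, §1 (6) p. 3 and (9), (11) p. 7] -/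
def flowInv (α t : ℝ) : UnitAddTorus (Fin 2) → UnitAddTorus (Fin 2) :=
  (periodInv α)^[⌊t⌋₊] ∘ withinPeriodInv α (t - ⌊t⌋₊)

/-! ## Definition 1.1 (dissipation enhancing) and Definition 1.2 (exponential mixer) -/

/-- **The decay inequality of Definition 1.1 at one diffusivity `ν`, with rate `r` and constant
`C`**: "for all `f₀ ∈ L²` the solution `f` of (1) satisfies
`‖f(t) - ⨍f₀‖_{L²} ≤ C e^{-rt} ‖f₀ - ⨍f₀‖_{L²}` for all `t ≥ 0`" — rendered (module docstring 3.):
for every `T > 0`, every weak solution `θ` of `∂ₜθ + u·∇θ = νΔθ`, `θ(0) = f₀` on `𝕋² × [0,T)`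
which is the `L²`-continuous representative on `[0,T)` obeys the squared inequality at every
`t ∈ [0,T)`; `⨍f₀ = ∫ f₀` (`𝕋²` has volume one). [cite: ElgindiLissMattingly2025, Def. 1.1 p. 2] -/
def DecaysAtRate (ν : ℝ) (u : ℝ → UnitAddTorus (Fin 2) → EuclideanSpace ℝ (Fin 2)) (r C : ℝ) :
    Prop :=
  ∀ f₀ : UnitAddTorus (Fin 2) → ℝ, MemLp f₀ 2 volume →
    ∀ (T : ℝ) (θ : ℝ → UnitAddTorus (Fin 2) → ℝ), 0 < T →
      Torus.IsWeakScalarTransportOn T ν u f₀ θ → Torus.IsL2ContinuousOn (Ico 0 T) θ →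
        ∀ t ∈ Ico 0 T,
          Torus.scalarL2Sq (fun x => θ t x - ∫ y, f₀ y) ≤
            (C * Real.exp (-(r * t))) ^ 2 * Torus.scalarL2Sq (fun x => f₀ x - ∫ y, f₀ y)

/-- **Definition 1.1 (dissipation enhancing)**, verbatim over `DecaysAtRate`: there are `C ≥ 1` and
a rate function `δ : (0,∞) → (0,∞)` with `ν/δ(ν) → 0` as `ν → 0⁺` such that for every `ν > 0`
the solutions decay at rate `δ(ν)` with constant `C` (values of `δ` at `ν ≤ 0` are irrelevant).
[cite: ElgindiLissMattingly2025, Def. 1.1 p. 2] -/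
def IsDissipationEnhancing (u : ℝ → UnitAddTorus (Fin 2) → EuclideanSpace ℝ (Fin 2)) : Prop :=
  ∃ C : ℝ, 1 ≤ C ∧ ∃ δ : ℝ → ℝ, (∀ ν : ℝ, 0 < ν → 0 < δ ν) ∧
    Tendsto (fun ν => ν / δ ν) (𝓝[>] 0) (𝓝 0) ∧ ∀ ν : ℝ, 0 < ν → DecaysAtRate ν u (δ ν) C

/-- **Definition 1.2 (exponential mixer)** for a flow presented by its inverse maps
`Φinv t = φ_t⁻¹` (so that the transported scalar is `f ∘ Φinv t`, (6) p. 3): there exist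
`C, c > 0` with `|∫ (f ∘ φ_t⁻¹) g - ∫ f ∫ g| ≤ C e^{-ct} ‖f‖_{C¹} ‖g‖_{C¹}` for all `t ≥ 0` and all
`f, g ∈ C¹(𝕋²)`; `‖·‖_{C¹}` = `eBoundedHolderNorm 1` (module docstring 5.).
[cite: ElgindiLissMattingly2025, Def. 1.2 p. 3] -/
def IsExponentialMixer (Φinv : ℝ → UnitAddTorus (Fin 2) → UnitAddTorus (Fin 2)) : Prop :=
  ∃ C c : ℝ, 0 < C ∧ 0 < c ∧ ∀ t : ℝ, 0 ≤ t →
    ∀ f g : UnitAddTorus (Fin 2) → ℝ, Torus.IsContDiff 1 f → Torus.IsContDiff 1 g →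
      |(∫ z, f (Φinv t z) * g z) - (∫ z, f z) * ∫ z, g z| ≤
        C * Real.exp (-(c * t)) * (eBoundedHolderNorm 1 f).toReal * (eBoundedHolderNorm 1 g).toReal

/-! ## The pulsed diffusion (9) -/

/-- **The pulsed diffusion** `Φ_ν g = e^{νΔ}(g ∘ T)`, `T = φ₁⁻¹`, `e^{νΔ}` = convolution with the
periodized heat kernel `p_ν` of the unit torus ((9) p. 7): transport by one period of `u_α`, then
heat flow for unit time at diffusivity `ν`. Iterates `Φ_ν^n = (pulsedDiffusion α ν)^[n]` ((11)).
[cite: ElgindiLissMattingly2025, (9) and (11) p. 7] -/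
def pulsedDiffusion (α ν : ℝ) (g : UnitAddTorus (Fin 2) → ℝ) : UnitAddTorus (Fin 2) → ℝ :=
  fun z => ∫ y, Torus.heatKernel ν (z - y) * g (periodInv α y)

end ElgindiLissMattingly2025

open FunctionSpaces ElgindiLissMattingly2025

/-- **Elgindi–Liss–Mattingly 2025, Theorem 1 (optimal enhanced dissipation on the `|log ν|`
time scale)**, verbatim p. 3: "If `α` is a sufficiently large even integer, then the velocity field
`u_α` is dissipation enhancing with the optimal rate function `δ(ν) = c/|log ν|`, where `c > 0` is a
constant depending on `α` but not `ν`." Typed (module docstring 3., 4., 6.): there is `α₀` such that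
for every even integer `α ≥ α₀` there are `C ≥ 1` and `c > 0` with, for every `ν ∈ (0, 1/2]`, every
`f₀ ∈ L²(𝕋²)` and every `t ≥ 0`,
`‖f(t) - ⨍f₀‖_{L²} ≤ C e^{-(c/|log ν|) t} ‖f₀ - ⨍f₀‖_{L²}` for the solution `f` of
`∂ₜf + u_α·∇f = νΔf` (`DecaysAtRate ν (field α) (c/|log ν|) C`). The rate is optimal in `ν` for
uniformly Lipschitz fields (p. 3). [cite: ElgindiLissMattingly2025, Thm. 1 p. 3 (with Def. 1.1 p. 2; ν ∈ (0,1/2] as in Thm. 3 p. 10 and §2.4 p. 12)] -/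
def ElgindiLissMattingly2025_thm1 : Prop :=
  ∃ α₀ : ℕ, ∀ α : ℕ, α₀ ≤ α → Even α →
    ∃ C : ℝ, 1 ≤ C ∧ ∃ c : ℝ, 0 < c ∧
      ∀ ν ∈ Ioc (0 : ℝ) (1 / 2), DecaysAtRate ν (field α) (c / |Real.log ν|) C

/-- **Elgindi–Liss–Mattingly 2025, Theorem 2 (exponential mixing)**, verbatim p. 4: "If `α` is a
sufficiently large even integer, then `u_α` is exponentially mixing in the sense of Definition 1.2."
Typed over the explicit inverse flow `flowInv α t = φ_t⁻¹` (module docstring 2., 5., 6.):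
`|∫ (f ∘ φ_t⁻¹) g - ∫ f ∫ g| ≤ C e^{-ct} ‖f‖_{C¹} ‖g‖_{C¹}` for all `t ≥ 0`, `f, g ∈ C¹(𝕋²)`.
"Sufficiently large" is necessary here (Rmk. 1.3). [cite: ElgindiLissMattingly2025, Thm. 2 p. 4 (with Def. 1.2 p. 3)] -/
def ElgindiLissMattingly2025_thm2 : Prop :=
  ∃ α₀ : ℕ, ∀ α : ℕ, α₀ ≤ α → Even α → IsExponentialMixer (flowInv α)

/-- **Elgindi–Liss–Mattingly 2025, Theorem 3 (optimal convergence of the pulsed diffusion)**,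
verbatim p. 10: "For all `α` sufficiently large [an even integer, §2.1] there exist constants
`C, c > 0` such that for any `ν ∈ (0,1/2]`, `p ∈ {2,∞}`, and mean-zero `f ∈ L^p(𝕋²)` there holds
`‖Φ_ν^n f‖_{L^p} ≤ C e^{-cn|log ν|⁻¹} ‖f‖_{L^p}`" (all `n ∈ ℕ`; `Φ_ν` = `pulsedDiffusion α ν`, (9)).
Typed with Mathlib's `eLpNorm`, the cases `p = 2` and `p = ∞` as two clauses (module docstring 7.).
[cite: ElgindiLissMattingly2025, Thm. 3 p. 10 (with (9), (11) p. 7)] -/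
def ElgindiLissMattingly2025_thm3 : Prop :=
  ∃ α₀ : ℕ, ∀ α : ℕ, α₀ ≤ α → Even α →
    ∃ C c : ℝ, 0 < C ∧ 0 < c ∧ ∀ ν ∈ Ioc (0 : ℝ) (1 / 2), ∀ n : ℕ,
      ∀ f : UnitAddTorus (Fin 2) → ℝ, ∫ z, f z = 0 →
        (MemLp f 2 volume →
          eLpNorm ((pulsedDiffusion α ν)^[n] f) 2 volume ≤
            ENNReal.ofReal (C * Real.exp (-(c * n / |Real.log ν|))) * eLpNorm f 2 volume) ∧
        (MemLp f ∞ volume →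
          eLpNorm ((pulsedDiffusion α ν)^[n] f) ∞ volume ≤
            ENNReal.ofReal (C * Real.exp (-(c * n / |Real.log ν|))) * eLpNorm f ∞ volume)

end Literature.Analysis.FluidPDE

end
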